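import Mathlib

/-!
# BlochSeedDiscOne — the dual-certificate family (lens `dual`, g3): REALISABILITY = CLASS-FULL ∧ ALIVE, and the BENDERS CUTS

Companion to `DualCertificateLaw.lean` (g0), `DualCertificateLawBand.lean` (g1), `DualCertificateLawFamily.lean` (g2).
Evidence-grade kernel facts (finite sums over `ℚ`, `linarith`) about the CLASS side of the pad-4 frame; nothing in this file is a
step toward `HC`, `HC_CM`, `HC_AV`, crux ℤ4/26512/18881/H2 — seats produce evidence and typed files, not rungs.

## Setting

A universe is a finite column type `ι` (the G₁-orbits of a residual map of record), a family of balance rows `A r : ι → ℚ`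
(`r ∈ R`, the (H1) word functionals — seven invariant rows on a line universe, thirteen word rows on a band universe) and one
functional `φ : ι → ℚ` (a signed `μ`-component, `± Re μ` or `± Im μ`, or a ray functional).  A design is `m : ι → ℚ`;
`Balanced R A m` says every row vanishes on `m`.  A support `Y : Finset ι` is

* REALISED by `m` (`Realises`) when `m ≥ 1` on `Y`, `m = 0` off `Y`, `m` is balanced and `φ·m > 0` — i.e. `supp m = Y` exactly
  (the static admissibility of a sheaf support is a property of the EXACT support, decided outside Lean by the residual CNF of record);
* CLASS-FULL (`ClassFull`) when some balanced `m ≥ 1` on `Y`, `= 0` off `Y` exists (no sign condition);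
* ALIVE (`Alive`) when some balanced `m ≥ 0`, `= 0` off `Y`, has `φ·m > 0` (no positivity-on-`Y` condition).

## What is certified here (all `h`, all bands: no census enters the hypotheses)

* §1 `realisable_iff_classFull_and_alive` : `(∃ m, Realises R A φ Y m) ↔ ClassFull R A Y ∧ Alive R A φ Y`
  (← : `m + λ m′` with `λ = (|φ·m| + 1)/(φ·m′)`).  This is the lemma that splits the realisability decision into two LPs per support.
* §2 THE CUTS ARE VALID.  For a certificate `(f₁, f₂)` put `G i := Σ_{r∈R} f₁ r · A r i + f₂ · φ i`.  On every balanced `m ≥ 0`: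
  `Σ_i G i · m i = f₂ · (φ·m)` (`cert_pairing`).  Hence
  - `cut_pos`  : `f₂ > 0`, `φ·m > 0` ⇒ some column with `m i > 0` has `G i > 0`  (clause `∨_{G>0} y_i` holds on `supp m`);
  - `cut_zero` : `f₂ = 0`, some column of `supp m` has `G < 0` ⇒ some column of `supp m` has `G > 0`  (clauses `y_c → ∨_{G>0} y_i`);
  - `cone_dead_of_dual` : a dual vector with `φ i ≤ Σ_r y r · A r i + y₀` for all `i` and `y₀ ≤ 0` forces `φ·m ≤ 0` on every balanced
    `m ≥ 0` (the `DEAD-CONE` certificate; with the columns restricted to a sub-universe it is the `alive` cut).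
* §3 `dead_of_master_unsat` : the logical skeleton of the census verdict `DEAD-STATIC` — if every static support realised by some design
  satisfies every recorded clause, and (externally: cadical UNSAT on residual.cnf ∧ clauses) no static support satisfies all clauses, then no
  static support is realised.  Stated with `Static` and the clause family abstract; the two external inputs are hypotheses, not kernel facts.

Census instances (the 36-cell table (h; band) ∈ {(12; 0,2,4,6,8), (14; 0,4,6), (16; 0)} × {Re, Im} × {+, −}, the eight realised compass
rays of `μ` at (14,4), (14,6), (16,0), the irreducible realised supports, the unique static-only death (14, 0, +Re)) are DATA in the memo
`DUAL-CERT-FAMILY-g3.md` (every verdict carries an exact certificate re-checked by an independent script), not kernel facts.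
-/

set_option linter.dupNamespace false

namespace Summit.HodgeConjecture.HodgeConjecture.Cruxes.BlochSeedDiscOne.DualLawRealise

open Finset BigOperators

variable {ι : Type*} [Fintype ι] {ρ : Type*}

/-- every balance row `r ∈ R` vanishes on the design `m`. -/
def Balanced (R : Finset ρ) (A : ρ → ι → ℚ) (m : ι → ℚ) : Prop := ∀ r ∈ R, ∑ i, A r i * m i = 0

/-- `m` realises the support `Y` for the functional `φ`: `m ≥ 1` exactly on `Y`, `0` off `Y`, balanced, `φ·m > 0`. -/
def Realises (R : Finset ρ) (A : ρ → ι → ℚ) (φ : ι → ℚ) (Y : Finset ι) (m : ι → ℚ) : Prop :=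
  (∀ i, i ∈ Y → 1 ≤ m i) ∧ (∀ i, i ∉ Y → m i = 0) ∧ Balanced R A m ∧ 0 < ∑ i, φ i * m i

/-- `Y` is the exact support of some balanced design. -/
def ClassFull (R : Finset ρ) (A : ρ → ι → ℚ) (Y : Finset ι) : Prop :=
  ∃ m : ι → ℚ, (∀ i, i ∈ Y → 1 ≤ m i) ∧ (∀ i, i ∉ Y → m i = 0) ∧ Balanced R A m

/-- some balanced nonnegative design supported inside `Y` has `φ·m > 0`. -/
def Alive (R : Finset ρ) (A : ρ → ι → ℚ) (φ : ι → ℚ) (Y : Finset ι) : Prop :=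
  ∃ m : ι → ℚ, (∀ i, 0 ≤ m i) ∧ (∀ i, i ∉ Y → m i = 0) ∧ Balanced R A m ∧ 0 < ∑ i, φ i * m i

section criterion
variable (R : Finset ρ) (A : ρ → ι → ℚ) (φ : ι → ℚ) (Y : Finset ι)

theorem balanced_add_smul {R : Finset ρ} {A : ρ → ι → ℚ} {m m' : ι → ℚ} (hm : Balanced R A m) (hm' : Balanced R A m') (c : ℚ) :
    Balanced R A (fun i => m i + c * m' i) := by
  intro r hr
  have h1 := hm r hr; have h2 := hm' r hr
  have : ∑ i, A r i * (m i + c * m' i) = (∑ i, A r i * m i) + c * ∑ i, A r i * m' i := by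
    rw [Finset.mul_sum, ← Finset.sum_add_distrib]; apply Finset.sum_congr rfl; intro i _; ring
  rw [this, h1, h2]; ring

theorem pairing_add_smul (φ m m' : ι → ℚ) (c : ℚ) :
    ∑ i, φ i * (m i + c * m' i) = (∑ i, φ i * m i) + c * ∑ i, φ i * m' i := by
  rw [Finset.mul_sum, ← Finset.sum_add_distrib]; apply Finset.sum_congr rfl; intro i _; ring

/-- §1: a support is realised iff it is class-full and alive. -/
theorem realisable_iff_classFull_and_alive :
    (∃ m, Realises R A φ Y m) ↔ ClassFull R A Y ∧ Alive R A φ Y := by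
  constructor
  · rintro ⟨m, h1, h0, hb, hφ⟩
    refine ⟨⟨m, h1, h0, hb⟩, ⟨m, ?_, h0, hb, hφ⟩⟩
    intro i
    by_cases hi : i ∈ Y
    · linarith [h1 i hi]
    · rw [h0 i hi]
  · rintro ⟨⟨m, h1, h0, hb⟩, ⟨m', h0', hz', hb', hφ'⟩⟩
    set P := ∑ i, φ i * m i with hP
    set Q := ∑ i, φ i * m' i with hQ
    have hQpos : 0 < Q := hφ'
    set c := (|P| + 1) / Q with hc
    have hcpos : 0 < c := by rw [hc]; positivity
    refine ⟨fun i => m i + c * m' i, ?_, ?_, balanced_add_smul hb hb' c, ?_⟩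
    · intro i hi
      have := h1 i hi; have := h0' i; nlinarith
    · intro i hi
      simp [h0 i hi, hz' i hi]
    · rw [pairing_add_smul, ← hP, ← hQ]
      have : c * Q = |P| + 1 := by rw [hc]; field_simp
      rw [this]
      have := neg_abs_le P
      linarith

end criterion

section cuts
variable (R : Finset ρ) (A : ρ → ι → ℚ) (φ : ι → ℚ)

/-- the cut functional of a certificate `(f₁, f₂)`. -/
def G (f₁ : ρ → ℚ) (f₂ : ℚ) (i : ι) : ℚ := (∑ r ∈ R, f₁ r * A r i) + f₂ * φ i

/-- on a balanced design the certificate pairs to `f₂ · (φ·m)`. -/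
theorem cert_pairing (f₁ : ρ → ℚ) (f₂ : ℚ) {m : ι → ℚ} (hb : Balanced R A m) :
    ∑ i, G R A φ f₁ f₂ i * m i = f₂ * ∑ i, φ i * m i := by
  have hrows : ∑ i, (∑ r ∈ R, f₁ r * A r i) * m i = 0 := by
    have : ∑ i, (∑ r ∈ R, f₁ r * A r i) * m i = ∑ i, ∑ r ∈ R, f₁ r * (A r i * m i) := by
      apply Finset.sum_congr rfl; intro i _; rw [Finset.sum_mul]; apply Finset.sum_congr rfl; intro r _; ring
    rw [this, Finset.sum_comm]
    apply Finset.sum_eq_zero; intro r hr; rw [← Finset.mul_sum, hb r hr]; ring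
  unfold G
  have : ∑ i, ((∑ r ∈ R, f₁ r * A r i) + f₂ * φ i) * m i
      = (∑ i, (∑ r ∈ R, f₁ r * A r i) * m i) + f₂ * ∑ i, φ i * m i := by
    rw [Finset.mul_sum, ← Finset.sum_add_distrib]; apply Finset.sum_congr rfl; intro i _; ring
  rw [this, hrows]; ring

/-- §2a (`f₂ > 0`): every balanced nonnegative design with `φ·m > 0` has a column of its support where the cut functional is positive. -/
theorem cut_pos (f₁ : ρ → ℚ) {f₂ : ℚ} (hf₂ : 0 < f₂) {m : ι → ℚ} (hm : ∀ i, 0 ≤ m i) (hb : Balanced R A m)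
    (hφ : 0 < ∑ i, φ i * m i) : ∃ i, 0 < m i ∧ 0 < G R A φ f₁ f₂ i := by
  by_contra h
  push Not at h
  have hle : ∑ i, G R A φ f₁ f₂ i * m i ≤ 0 := by
    apply Finset.sum_nonpos; intro i _
    rcases eq_or_lt_of_le (hm i) with h0 | hpos
    · rw [← h0]; simp
    · have := h i hpos; nlinarith
  rw [cert_pairing R A φ f₁ f₂ hb] at hle
  nlinarith

/-- §2b (`f₂ = 0`): on a balanced nonnegative design, a support column with negative cut value forces one with positive cut value. -/
theorem cut_zero (f₁ : ρ → ℚ) {m : ι → ℚ} (hm : ∀ i, 0 ≤ m i) (hb : Balanced R A m)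
    (hneg : ∃ i, 0 < m i ∧ G R A φ f₁ 0 i < 0) : ∃ j, 0 < m j ∧ 0 < G R A φ f₁ 0 j := by
  obtain ⟨i₀, hi₀, hGi₀⟩ := hneg
  by_contra h
  push Not at h
  have hsum : ∑ i, G R A φ f₁ 0 i * m i = 0 := by rw [cert_pairing R A φ f₁ 0 hb]; ring
  have hterm : ∀ i, G R A φ f₁ 0 i * m i ≤ 0 := by
    intro i
    rcases eq_or_lt_of_le (hm i) with h0 | hpos
    · rw [← h0]; simp
    · have := h i hpos; nlinarith
  have hle : ∑ i, G R A φ f₁ 0 i * m i ≤ G R A φ f₁ 0 i₀ * m i₀ := by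
    have := Finset.single_le_sum (f := fun i => -(G R A φ f₁ 0 i * m i)) (s := Finset.univ)
      (fun i _ => neg_nonneg.mpr (hterm i)) (Finset.mem_univ i₀)
    simp only [Finset.sum_neg_distrib] at this
    linarith
  have hneg' : G R A φ f₁ 0 i₀ * m i₀ < 0 := by nlinarith
  linarith

/-- §2c: an exact dual certificate kills the cone — `φ i ≤ Σ_r y r · A r i + y₀` columnwise with `y₀ ≤ 0` gives `φ·m ≤ 0` on every
balanced nonnegative design (restricted to a sub-universe `S` by asking `m = 0` off `S` and the inequality only on `S`). -/
theorem cone_dead_of_dual (S : Finset ι) (y : ρ → ℚ) {y₀ : ℚ} (hy₀ : y₀ ≤ 0)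
    (hy : ∀ i ∈ S, φ i ≤ (∑ r ∈ R, y r * A r i) + y₀) {m : ι → ℚ} (hm : ∀ i, 0 ≤ m i) (hS : ∀ i, i ∉ S → m i = 0)
    (hb : Balanced R A m) : ∑ i, φ i * m i ≤ 0 := by
  have h1 : ∑ i, φ i * m i ≤ ∑ i, ((∑ r ∈ R, y r * A r i) + y₀) * m i := by
    apply Finset.sum_le_sum; intro i _
    by_cases hi : i ∈ S
    · exact mul_le_mul_of_nonneg_right (hy i hi) (hm i)
    · rw [hS i hi]; simp
  have h2 : ∑ i, ((∑ r ∈ R, y r * A r i) + y₀) * m i = y₀ * ∑ i, m i := by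
    have := cert_pairing R A (fun _ => (1 : ℚ)) y y₀ hb
    unfold G at this
    simpa using this
  rw [h2] at h1
  have h3 : 0 ≤ ∑ i, m i := Finset.sum_nonneg (fun i _ => hm i)
  nlinarith

end cuts

section master
variable {κ : Type*}

/-- §3: the skeleton of a `DEAD-STATIC` verdict.  `Static Y` is the external static predicate (a model of the residual CNF of record),
`Clause k Y` the `k`-th recorded cut clause read on the support `Y`.  Hypotheses: (i) every realised static support satisfies every clause
(§2 for the recorded certificates); (ii) no static support satisfies all clauses (the external UNSAT).  Conclusion: nothing static is realised. -/
theorem dead_of_master_unsat (R : Finset ρ) (A : ρ → ι → ℚ) (φ : ι → ℚ) (Static : Finset ι → Prop) (Clause : κ → Finset ι → Prop)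
    (hvalid : ∀ Y m, Static Y → Realises R A φ Y m → ∀ k, Clause k Y)
    (hunsat : ∀ Y, Static Y → ∃ k, ¬ Clause k Y) :
    ∀ Y m, Static Y → ¬ Realises R A φ Y m := by
  intro Y m hS hR
  obtain ⟨k, hk⟩ := hunsat Y hS
  exact hk (hvalid Y m hS hR k)

/-- the clause shapes used by the census, read on a support: `∨_{i ∈ P} (i ∈ Y)` and `(c ∈ Y) → ∨_{i ∈ P} (i ∈ Y)`; §2 shows a realised
support satisfies them when `P = {G > 0}` (and `c ∈ {G < 0}` for the second), because `supp m = Y` exactly. -/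
theorem clause_pos_of_realises (R : Finset ρ) (A : ρ → ι → ℚ) (φ : ι → ℚ) (f₁ : ρ → ℚ) {f₂ : ℚ} (hf₂ : 0 < f₂)
    {Y : Finset ι} {m : ι → ℚ} (h : Realises R A φ Y m) : ∃ i ∈ Y, 0 < G R A φ f₁ f₂ i := by
  obtain ⟨h1, h0, hb, hφ⟩ := h
  have hm : ∀ i, 0 ≤ m i := by
    intro i; by_cases hi : i ∈ Y
    · linarith [h1 i hi]
    · rw [h0 i hi]
  obtain ⟨i, hi, hG⟩ := cut_pos R A φ f₁ hf₂ hm hb hφ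
  refine ⟨i, ?_, hG⟩
  by_contra hiY; have := h0 i hiY; linarith

theorem clause_zero_of_realises (R : Finset ρ) (A : ρ → ι → ℚ) (φ : ι → ℚ) (f₁ : ρ → ℚ)
    {Y : Finset ι} {m : ι → ℚ} (h : Realises R A φ Y m) {c : ι} (hc : c ∈ Y) (hGc : G R A φ f₁ 0 c < 0) :
    ∃ j ∈ Y, 0 < G R A φ f₁ 0 j := by
  obtain ⟨h1, h0, hb, hφ⟩ := h
  have hm : ∀ i, 0 ≤ m i := by
    intro i; by_cases hi : i ∈ Y
    · linarith [h1 i hi]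
    · rw [h0 i hi]
  obtain ⟨j, hj, hG⟩ := cut_zero R A φ f₁ hm hb ⟨c, by linarith [h1 c hc], hGc⟩
  refine ⟨j, ?_, hG⟩
  by_contra hjY; have := h0 j hjY; linarith

end master

end Summit.HodgeConjecture.HodgeConjecture.Cruxes.BlochSeedDiscOne.DualLawRealise
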